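/-
Copyright (c) 2026 the pub-hodgecm-mathlib formalisation cell (harness21).  Prover seat hodgecm-mathlib-K2E4-p11 (g9): Track B «K2-LIT»,
hLiu418 = stmt-HodgeConjecture-24832, socket #41 KIND W, organ «Φ6b-ind» FILE 3b (LEAD F0P6-plan (g14) BATCH #178 (1), KW desk F0P2-p08 (g3)):
THE CAYLEY RECURSION OF SHIMURA's ξ ON `Herm₂(ℂ)` AT EVERY SIGNATURE —
`−4π²·det(h)·ξ(g,h;α,β) = (α+β−1)·(α ξ(α+1,β) + β ξ(α,β+1)) + 4αβ·det(g)·ξ(α+1,β+1)`  (`g > 0`, `h = h*`, `re(α+β) > 3`).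
THEOREMS ONLY (no `def`, no `instance`, no `notation`, no named-fact hypothesis, no `sorry`).
-/
import Summits.HodgeConjecture.HodgeConjecture.Theorems.K2LiuHermTwoXiIntegrandCayley        -- ★ FILE 2b (this seat): second derivatives, the Cayley identities
import Summits.HodgeConjecture.HodgeConjecture.Theorems.K2LiuHermTwoXiCayleyIntegrability    -- ★ FILE 3a (this seat): integrability of every IBP term
import Mathlib.Analysis.Calculus.LineDeriv.IntegrationByParts
import Mathlib.MeasureTheory.Group.Measure
import Mathlib.MeasureTheory.Measure.Lebesgue.Complex
import HarnessLib

/-!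
# Crux `HLiu418`, ROAD Φ ∕ KIND W organ «Φ6b-ind», FILE 3b: THE CAYLEY RECURSION of Shimura's `ξ(g, h; α, β)` on `Herm₂(ℂ)`

Cell `hodgecm-mathlib`, crux item hLiu418 = `stmt-HodgeConjecture-24832` (helper lane `--supports … --as helper`, count-neutral), route of record
`HCCMUnconditional`; squad K2 ∕ K2Liu, road `K2_Liu`, socket #41, KIND W.  Sequel of ★ FILE 2a∕2b∕3a.

THE RECURSION.  For a positive definite `g`, a HERMITIAN `h` OF ANY SIGNATURE and `re(α+β) > 3` (absolute convergence of `ξ = xiTwo`, ★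
`integrable_xiTwoIntegrand`):
  **`−4π²·det(h)·ξ(g,h;α,β) = (α+β−1)·(α·ξ(g,h;α+1,β) + β·ξ(g,h;α,β+1)) + 4αβ·det(g)·ξ(g,h;α+1,β+1)`**  (`xiTwo_cayley_recursion`).
Since the right-hand side only involves `ξ` at `α + β` raised by `1` or `2`, for `det h ≠ 0` this continues `ξ(g, h; ·, ·)` from the half-space
`{re(α+β) > 3}` to all of `ℂ²` by induction (FILE 4) — Shimura's analytic continuation [Shimura1982, Thm. 3.1 ∕ §4 Thm. 4.2, continuation half] for
NON-DEGENERATE indices of every signature, in particular the INDEFINITE indices of the KIND-W archimedean letter («Φ6b-ind»).  (The growth half —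
decay in `h` below `re α = 1` — is NOT given by this road.)  Consistency: at `h = 0` the right-hand side vanishes identically against ★ `xiTwo_zero_right`.
PROOF.  `ξ(g,h;α,β) = ∫ E·Φ_{α,β}` with `E = e(−τ(hx))`, `Φ_{α,β} = xiTwoIntegrand g 0 α β` (★ FILE 2a `xiTwoIntegrand_eq_cexp_mul_zero`).  Along a chart
direction `v`, `D_v E = k_v·E` with the CONSTANT `k_v = −2πi·τ(h·hermTwo v)` (★ `hasLineDerivAt_cexp_trace`).  §1: one integration by parts on
`ℝ × ℂ × ℝ` (Mathlib `integral_bilinear_hasLineDerivAt_right_eq_neg_left_of_integrable` for the bilinear map `mul`, Lebesgue = additive Haar) gives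
`∫ E·D_vΦ = −k_v·ξ(α,β)`, and a second one `∫ E·D_{v′}D_vΦ = k_v k_{v′}·ξ(α,β)`; all products are integrable by ★ FILE 3a (majorant `‖ξ-integrand‖`).
§2: summing over the Cayley combination `L = D_bD_a − ¼(D_u² + D_v²)` and using ★ FILE 2b `cayley_xiTwoIntegrand_zero` pointwise,
`(k_a k_b − ¼(k_u² + k_v²))·ξ = ∫ E·LΦ = (α+β−1)(α ξ(α+1,β) + β ξ(α,β+1)) + 4αβ det(g) ξ(α+1,β+1)`, and `k_a k_b − ¼(k_u² + k_v²) = −4π²·det h`.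
[Shimura1982, §1 (1.25), §3 (3.4)–(3.7), Thm. 3.1] [Shimura1997, §16.4–16.5] [FarautKoranyi1994, Ch. VII §1].
HONEST LABEL.  Count-neutral helper of the K2_Liu road; it pays no socket by itself: `HC_CM` is proved only modulo the 7 printed citations
(2 remaining named inputs: hLiu418 = `stmt-HodgeConjecture-24832`, h413 = `stmt-HodgeConjecture-24833`) until rung 0 closes.

## References
* [Shimura1982] G. Shimura, *Confluent hypergeometric functions on tube domains*, Math. Ann. 260 (1982) 269–302: §1 (1.25), §3, Thm. 3.1, §4 Thm. 4.2.
* [Shimura1997] G. Shimura, *Euler Products and Eisenstein Series*, CBMS 93 (1997): §16.4–16.5.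
* [FarautKoranyi1994] J. Faraut, A. Korányi, *Analysis on Symmetric Cones* (1994): Ch. VII §1.
-/

set_option autoImplicit false
-- the mandated namespace repeats the single-problem summit's segment (`HodgeConjecture.HodgeConjecture`)
set_option linter.dupNamespace false

noncomputable section

open Complex MeasureTheory Set
open scoped ComplexOrder ComplexConjugate

namespace Summit.HodgeConjecture.HodgeConjecture.Cruxes.HLiu418.K2LiuHermTwoXiCayleyRecursion

open Summit.HodgeConjecture.HodgeConjecture.Cruxes.HLiu418.K2LiuHermTwoGammaDefs
open Summit.HodgeConjecture.HodgeConjecture.Cruxes.HLiu418.K2LiuHermTwoDetPowerIntegrable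
open Summit.HodgeConjecture.HodgeConjecture.Cruxes.HLiu418.K2LiuHermTwoConfluentXiDefs
open Summit.HodgeConjecture.HodgeConjecture.Cruxes.HLiu418.K2LiuHermTwoConfluentXiConvergence
open Summit.HodgeConjecture.HodgeConjecture.Cruxes.HLiu418.K2LiuHermTwoEtaDefs
open Summit.HodgeConjecture.HodgeConjecture.Cruxes.HLiu418.K2LiuHermTwoXiIntegrandLineDeriv
open Summit.HodgeConjecture.HodgeConjecture.Cruxes.HLiu418.K2LiuHermTwoXiIntegrandCayley
open Summit.HodgeConjecture.HodgeConjecture.Cruxes.HLiu418.K2LiuHermTwoXiCayleyIntegrability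

/-! ## §0 Integration by parts on the chart, scalar form -/

/-- **INTEGRATION BY PARTS ON `Herm₂(ℂ) ≅ ℝ × ℂ × ℝ` ALONG A DIRECTION `v`** (scalar form of Mathlib's
`integral_bilinear_hasLineDerivAt_right_eq_neg_left_of_integrable` for the bilinear map `mul`): `∫ f·g′ = −∫ f′·g`. [folklore] -/
theorem integral_mul_eq_neg_of_hasLineDerivAt {f f' g g' : ℝ × ℂ × ℝ → ℂ} {v : ℝ × ℂ × ℝ}
    (hf'g : Integrable (fun x => f' x * g x)) (hfg' : Integrable (fun x => f x * g' x)) (hfg : Integrable (fun x => f x * g x))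
    (hf : ∀ x, HasLineDerivAt ℝ f (f' x) x v) (hg : ∀ x, HasLineDerivAt ℝ g (g' x) x v) :
    ∫ x, f x * g' x = -∫ x, f' x * g x := by
  haveI : (volume : Measure (ℝ × ℂ × ℝ)).IsAddHaarMeasure := by
    rw [Measure.volume_eq_prod, Measure.volume_eq_prod]
    exact Measure.prod.instIsAddHaarMeasure _ _
  have h := integral_bilinear_hasLineDerivAt_right_eq_neg_left_of_integrable (μ := (volume : Measure (ℝ × ℂ × ℝ)))
    (B := ContinuousLinearMap.mul ℝ ℂ) (f := f) (f' := f') (g := g) (g' := g') (v := v)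
    (by simpa only [ContinuousLinearMap.mul_apply'] using hf'g) (by simpa only [ContinuousLinearMap.mul_apply'] using hfg')
    (by simpa only [ContinuousLinearMap.mul_apply'] using hfg) (fun x _ => hf x) (fun x _ => hg x)
  simpa only [ContinuousLinearMap.mul_apply'] using h

/-- The Cayley combination of the character's directional constants is `−4π²·det h` (any complex `h`):
`k_a k_b − ¼(k_u² + k_v²) = −4π² det h`, `k_v = −2πi·τ(h·hermTwo v)`. [folklore] -/
theorem cayley_charCoeff (h : Matrix (Fin 2) (Fin 2) ℂ) :
    (-(2 * Real.pi * I) * (h * hermTwo ((1 : ℝ), (0 : ℂ), (0 : ℝ))).trace) * (-(2 * Real.pi * I) * (h * hermTwo ((0 : ℝ), (0 : ℂ), (1 : ℝ))).trace) -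
        (1 / 4 : ℂ) * ((-(2 * Real.pi * I) * (h * hermTwo ((0 : ℝ), (1 : ℂ), (0 : ℝ))).trace) ^ 2 +
          (-(2 * Real.pi * I) * (h * hermTwo ((0 : ℝ), I, (0 : ℝ))).trace) ^ 2) =
      -(4 * Real.pi ^ 2) * h.det := by
  rw [Matrix.det_fin_two]
  simp only [hermTwo_dir_a, hermTwo_dir_b, hermTwo_dir_u, hermTwo_dir_v, Matrix.trace_fin_two, Matrix.mul_apply, Fin.sum_univ_two,
    Matrix.of_apply, Matrix.cons_val', Matrix.cons_val_zero, Matrix.cons_val_one, Matrix.empty_val', Matrix.cons_val_fin_one]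
  ring_nf
  simp only [Complex.I_sq, Complex.I_pow_four]
  ring

/-! ## §1 The character against the first and second line derivatives of `Φ_{α,β}` -/

section IBP

variable {g h : Matrix (Fin 2) (Fin 2) ℂ} {α β : ℂ}

/-- `e(−τ(hx))·Φ_{α,β}(x) = ξ-integrand`, so it is integrable. -/
theorem integrable_cexp_mul_xiTwoIntegrand_zero (hg : g.PosDef) (hh : h.IsHermitian) (hαβ : 3 < (α + β).re) :
    Integrable (fun c : ℝ × ℂ × ℝ => cexp (-(2 * Real.pi * I) * (h * hermTwo c).trace) * xiTwoIntegrand g 0 α β c) := by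
  have hf : (fun c : ℝ × ℂ × ℝ => cexp (-(2 * Real.pi * I) * (h * hermTwo c).trace) * xiTwoIntegrand g 0 α β c) = xiTwoIntegrand g h α β :=
    funext fun c => (xiTwoIntegrand_eq_cexp_mul_zero g h α β c).symm
  rw [hf]
  exact integrable_xiTwoIntegrand hg hh hαβ

/-- The character against `D_v Φ`, term by term: `E·D_vΦ = −iα·(tr(adj(Y)V)·ξ-integrand(α+1,β)) + iβ·(tr(adj(W)V)·ξ-integrand(α,β+1))`. -/
theorem cexp_mul_lineDeriv_eq (hg : g.PosDef) (c v : ℝ × ℂ × ℝ) :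
    cexp (-(2 * Real.pi * I) * (h * hermTwo c).trace) * lineDeriv ℝ (xiTwoIntegrand g 0 α β) c v =
      -(I * α) * (((g - I • hermTwo c).adjugate * hermTwo v).trace * xiTwoIntegrand g h (α + 1) β c) +
        I * β * (((g + I • hermTwo c).adjugate * hermTwo v).trace * xiTwoIntegrand g h α (β + 1) c) := by
  rw [lineDeriv_xiTwoIntegrand_zero hg, xiTwoIntegrand_eq_cexp_mul_zero g h (α + 1) β c, xiTwoIntegrand_eq_cexp_mul_zero g h α (β + 1) c]
  ring

/-- `E·D_vΦ` is integrable (★ FILE 3a (G1), (G2)). -/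
theorem integrable_cexp_mul_lineDeriv (hg : g.PosDef) (hh : h.IsHermitian) (hαβ : 3 < (α + β).re) (v : ℝ × ℂ × ℝ) :
    Integrable (fun c : ℝ × ℂ × ℝ => cexp (-(2 * Real.pi * I) * (h * hermTwo c).trace) * lineDeriv ℝ (xiTwoIntegrand g 0 α β) c v) := by
  have hf : (fun c : ℝ × ℂ × ℝ => cexp (-(2 * Real.pi * I) * (h * hermTwo c).trace) * lineDeriv ℝ (xiTwoIntegrand g 0 α β) c v) = fun c =>
      -(I * α) * (((g - I • hermTwo c).adjugate * hermTwo v).trace * xiTwoIntegrand g h (α + 1) β c) +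
        I * β * (((g + I • hermTwo c).adjugate * hermTwo v).trace * xiTwoIntegrand g h α (β + 1) c) :=
    funext fun c => cexp_mul_lineDeriv_eq hg c v
  rw [hf]
  exact ((integrable_polY_mul_succ_left hg hh hαβ (hermTwo v)).const_mul _).add ((integrable_polW_mul_succ_right hg hh hαβ (hermTwo v)).const_mul _)

/-- **ONE INTEGRATION BY PARTS**: `∫ e(−τ(hx))·D_vΦ_{α,β} dx = −k_v·ξ(g,h;α,β)`, `k_v = −2πi·τ(h·hermTwo v)`. [cite: Shimura1982, §3] -/
theorem integral_cexp_mul_lineDeriv (hg : g.PosDef) (hh : h.IsHermitian) (hαβ : 3 < (α + β).re) (v : ℝ × ℂ × ℝ) :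
    ∫ c : ℝ × ℂ × ℝ, cexp (-(2 * Real.pi * I) * (h * hermTwo c).trace) * lineDeriv ℝ (xiTwoIntegrand g 0 α β) c v =
      -(-(2 * Real.pi * I) * (h * hermTwo v).trace * xiTwo g h α β) := by
  have hI := integrable_cexp_mul_xiTwoIntegrand_zero hg hh hαβ
  have hibp := integral_mul_eq_neg_of_hasLineDerivAt (v := v)
    (f := fun c : ℝ × ℂ × ℝ => cexp (-(2 * Real.pi * I) * (h * hermTwo c).trace))
    (f' := fun c : ℝ × ℂ × ℝ => -(2 * Real.pi * I) * (h * hermTwo v).trace * cexp (-(2 * Real.pi * I) * (h * hermTwo c).trace))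
    (g := xiTwoIntegrand g 0 α β) (g' := fun c => lineDeriv ℝ (xiTwoIntegrand g 0 α β) c v)
    (by
      have e : (fun c : ℝ × ℂ × ℝ => -(2 * Real.pi * I) * (h * hermTwo v).trace * cexp (-(2 * Real.pi * I) * (h * hermTwo c).trace) *
          xiTwoIntegrand g 0 α β c) = fun c => -(2 * Real.pi * I) * (h * hermTwo v).trace *
          (cexp (-(2 * Real.pi * I) * (h * hermTwo c).trace) * xiTwoIntegrand g 0 α β c) := funext fun c => by ring
      rw [e]
      exact hI.const_mul _)
    (integrable_cexp_mul_lineDeriv hg hh hαβ v) hI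
    (fun c => hasLineDerivAt_cexp_trace h c v) (fun c => (hasLineDerivAt_xiTwoIntegrand_zero hg α β c v).lineDifferentiableAt.hasLineDerivAt)
  rw [hibp, xiTwo_def]
  have hpt : ∀ c : ℝ × ℂ × ℝ, -(2 * Real.pi * I) * (h * hermTwo v).trace * cexp (-(2 * Real.pi * I) * (h * hermTwo c).trace) *
      xiTwoIntegrand g 0 α β c = -(2 * Real.pi * I) * (h * hermTwo v).trace * xiTwoIntegrand g h α β c := fun c => by
    rw [xiTwoIntegrand_eq_cexp_mul_zero g h α β c]
    ring
  simp_rw [hpt, integral_const_mul]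

/-- The character against `D_{v′}D_vΦ`, term by term (six terms, each a polarisation product against a shifted ξ-integrand). -/
theorem cexp_mul_lineDeriv_lineDeriv_eq (hg : g.PosDef) (c v v' : ℝ × ℂ × ℝ) :
    cexp (-(2 * Real.pi * I) * (h * hermTwo c).trace) * lineDeriv ℝ (fun c : ℝ × ℂ × ℝ => lineDeriv ℝ (xiTwoIntegrand g 0 α β) c v) c v' =
      -(I * α * (-(I * ((hermTwo v').adjugate * hermTwo v).trace))) * xiTwoIntegrand g h (α + 1) β c +
        (-(I * α)) * (-(I * (α + 1))) *
          (((g - I • hermTwo c).adjugate * hermTwo v).trace * ((g - I • hermTwo c).adjugate * hermTwo v').trace * xiTwoIntegrand g h (α + 1 + 1) β c) +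
        (-(I * α)) * (I * β) *
          (((g - I • hermTwo c).adjugate * hermTwo v).trace * ((g + I • hermTwo c).adjugate * hermTwo v').trace * xiTwoIntegrand g h (α + 1) (β + 1) c) +
        I * β * (I * ((hermTwo v').adjugate * hermTwo v).trace) * xiTwoIntegrand g h α (β + 1) c +
        (I * β) * (-(I * α)) *
          (((g - I • hermTwo c).adjugate * hermTwo v').trace * ((g + I • hermTwo c).adjugate * hermTwo v).trace * xiTwoIntegrand g h (α + 1) (β + 1) c) +
        (I * β) * (I * (β + 1)) *
          (((g + I • hermTwo c).adjugate * hermTwo v).trace * ((g + I • hermTwo c).adjugate * hermTwo v').trace * xiTwoIntegrand g h α (β + 1 + 1) c) := by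
  rw [(hasLineDerivAt_lineDeriv_xiTwoIntegrand_zero hg α β c v v').lineDeriv, xiTwoIntegrand_eq_cexp_mul_zero g h (α + 1) β c,
    xiTwoIntegrand_eq_cexp_mul_zero g h α (β + 1) c, xiTwoIntegrand_eq_cexp_mul_zero g h (α + 1 + 1) β c,
    xiTwoIntegrand_eq_cexp_mul_zero g h (α + 1) (β + 1) c, xiTwoIntegrand_eq_cexp_mul_zero g h α (β + 1 + 1) c]
  ring

/-- `E·D_{v′}D_vΦ` is integrable (★ FILE 3a (G1)–(G5)). -/
theorem integrable_cexp_mul_lineDeriv_lineDeriv (hg : g.PosDef) (hh : h.IsHermitian) (hαβ : 3 < (α + β).re) (v v' : ℝ × ℂ × ℝ) :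
    Integrable (fun c : ℝ × ℂ × ℝ =>
      cexp (-(2 * Real.pi * I) * (h * hermTwo c).trace) * lineDeriv ℝ (fun c : ℝ × ℂ × ℝ => lineDeriv ℝ (xiTwoIntegrand g 0 α β) c v) c v') := by
  have hf := funext fun c => cexp_mul_lineDeriv_lineDeriv_eq (h := h) (α := α) (β := β) hg c v v'
  rw [hf]
  refine ((((((integrable_xiTwoIntegrand hg hh (by simp only [add_re, one_re] at hαβ ⊢; linarith)).const_mul _).add
    ((integrable_polY_polY_mul hg hh hαβ (hermTwo v) (hermTwo v')).const_mul _)).add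
    ((integrable_polY_polW_mul hg hh hαβ (hermTwo v) (hermTwo v')).const_mul _)).add
    ((integrable_xiTwoIntegrand hg hh (by simp only [add_re, one_re] at hαβ ⊢; linarith)).const_mul _)).add
    ((integrable_polY_polW_mul hg hh hαβ (hermTwo v') (hermTwo v)).const_mul _)).add
    ((integrable_polW_polW_mul hg hh hαβ (hermTwo v) (hermTwo v')).const_mul _)

/-- **TWO INTEGRATIONS BY PARTS**: `∫ e(−τ(hx))·D_{v′}D_vΦ_{α,β} dx = k_v·k_{v′}·ξ(g,h;α,β)`. [cite: Shimura1982, §3] -/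
theorem integral_cexp_mul_lineDeriv_lineDeriv (hg : g.PosDef) (hh : h.IsHermitian) (hαβ : 3 < (α + β).re) (v v' : ℝ × ℂ × ℝ) :
    ∫ c : ℝ × ℂ × ℝ, cexp (-(2 * Real.pi * I) * (h * hermTwo c).trace) * lineDeriv ℝ (fun c : ℝ × ℂ × ℝ => lineDeriv ℝ (xiTwoIntegrand g 0 α β) c v) c v' =
      (-(2 * Real.pi * I) * (h * hermTwo v).trace) * (-(2 * Real.pi * I) * (h * hermTwo v').trace) * xiTwo g h α β := by
  have hI1 := integrable_cexp_mul_lineDeriv hg hh hαβ v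
  have hibp := integral_mul_eq_neg_of_hasLineDerivAt (v := v')
    (f := fun c : ℝ × ℂ × ℝ => cexp (-(2 * Real.pi * I) * (h * hermTwo c).trace))
    (f' := fun c : ℝ × ℂ × ℝ => -(2 * Real.pi * I) * (h * hermTwo v').trace * cexp (-(2 * Real.pi * I) * (h * hermTwo c).trace))
    (g := fun c : ℝ × ℂ × ℝ => lineDeriv ℝ (xiTwoIntegrand g 0 α β) c v)
    (g' := fun c : ℝ × ℂ × ℝ => lineDeriv ℝ (fun c : ℝ × ℂ × ℝ => lineDeriv ℝ (xiTwoIntegrand g 0 α β) c v) c v')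
    (by
      have e : (fun c : ℝ × ℂ × ℝ => -(2 * Real.pi * I) * (h * hermTwo v').trace * cexp (-(2 * Real.pi * I) * (h * hermTwo c).trace) *
          lineDeriv ℝ (xiTwoIntegrand g 0 α β) c v) = fun c => -(2 * Real.pi * I) * (h * hermTwo v').trace *
          (cexp (-(2 * Real.pi * I) * (h * hermTwo c).trace) * lineDeriv ℝ (xiTwoIntegrand g 0 α β) c v) := funext fun c => by ring
      rw [e]
      exact hI1.const_mul _)
    (integrable_cexp_mul_lineDeriv_lineDeriv hg hh hαβ v v') hI1
    (fun c => hasLineDerivAt_cexp_trace h c v') (fun c => (hasLineDerivAt_lineDeriv_xiTwoIntegrand_zero hg α β c v v').lineDifferentiableAt.hasLineDerivAt)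
  rw [hibp]
  have hpt : ∀ c : ℝ × ℂ × ℝ, -(2 * Real.pi * I) * (h * hermTwo v').trace * cexp (-(2 * Real.pi * I) * (h * hermTwo c).trace) *
      lineDeriv ℝ (xiTwoIntegrand g 0 α β) c v = -(2 * Real.pi * I) * (h * hermTwo v').trace *
        (cexp (-(2 * Real.pi * I) * (h * hermTwo c).trace) * lineDeriv ℝ (xiTwoIntegrand g 0 α β) c v) := fun c => by ring
  simp_rw [hpt, integral_const_mul, integral_cexp_mul_lineDeriv hg hh hαβ v]
  ring

/-! ## §2 The recursion -/

/-- **THE CAYLEY RECURSION OF SHIMURA's `ξ` ON `Herm₂(ℂ)`, EVERY SIGNATURE** (organ «Φ6b-ind» FILE 3b): for `g > 0`, `h` Hermitian (definite,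
semidefinite or INDEFINITE) and `re(α+β) > 3`,
  `−4π²·det(h)·ξ(g,h;α,β) = (α+β−1)·(α·ξ(g,h;α+1,β) + β·ξ(g,h;α,β+1)) + 4αβ·det(g)·ξ(g,h;α+1,β+1)`.
Two integrations by parts per direction pair (§1) and the pointwise Cayley identity ★ `cayley_xiTwoIntegrand_zero`.
[cite: Shimura1982, §3 Thm. 3.1] [cite: Shimura1997, §16.4–16.5] [cite: FarautKoranyi1994, Ch. VII §1] -/
theorem xiTwo_cayley_recursion (hg : g.PosDef) (hh : h.IsHermitian) (hαβ : 3 < (α + β).re) :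
    -(4 * Real.pi ^ 2) * h.det * xiTwo g h α β =
      (α + β - 1) * (α * xiTwo g h (α + 1) β + β * xiTwo g h α (β + 1)) + 4 * α * β * g.det * xiTwo g h (α + 1) (β + 1) := by
  -- abbreviations for the three double integrations by parts
  have hab := integral_cexp_mul_lineDeriv_lineDeriv hg hh hαβ ((1 : ℝ), (0 : ℂ), (0 : ℝ)) ((0 : ℝ), (0 : ℂ), (1 : ℝ))
  have huu := integral_cexp_mul_lineDeriv_lineDeriv hg hh hαβ ((0 : ℝ), (1 : ℂ), (0 : ℝ)) ((0 : ℝ), (1 : ℂ), (0 : ℝ))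
  have hvv := integral_cexp_mul_lineDeriv_lineDeriv hg hh hαβ ((0 : ℝ), I, (0 : ℝ)) ((0 : ℝ), I, (0 : ℝ))
  have Iab := integrable_cexp_mul_lineDeriv_lineDeriv hg hh hαβ ((1 : ℝ), (0 : ℂ), (0 : ℝ)) ((0 : ℝ), (0 : ℂ), (1 : ℝ))
  have Iuu := integrable_cexp_mul_lineDeriv_lineDeriv hg hh hαβ ((0 : ℝ), (1 : ℂ), (0 : ℝ)) ((0 : ℝ), (1 : ℂ), (0 : ℝ))
  have Ivv := integrable_cexp_mul_lineDeriv_lineDeriv hg hh hαβ ((0 : ℝ), I, (0 : ℝ)) ((0 : ℝ), I, (0 : ℝ))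
  -- the three shifted ξ-integrands are integrable
  have h10 : Integrable (xiTwoIntegrand g h (α + 1) β) := integrable_xiTwoIntegrand hg hh (by simp only [add_re, one_re] at hαβ ⊢; linarith)
  have h01 : Integrable (xiTwoIntegrand g h α (β + 1)) := integrable_xiTwoIntegrand hg hh (by simp only [add_re, one_re] at hαβ ⊢; linarith)
  have h11 : Integrable (xiTwoIntegrand g h (α + 1) (β + 1)) := integrable_xiTwoIntegrand hg hh (by simp only [add_re, one_re] at hαβ ⊢; linarith)
  -- `∫ E·LΦ` computed from the three double integrations by parts …
  have hL : ∫ c : ℝ × ℂ × ℝ, cexp (-(2 * Real.pi * I) * (h * hermTwo c).trace) *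
      (lineDeriv ℝ (fun c : ℝ × ℂ × ℝ => lineDeriv ℝ (xiTwoIntegrand g 0 α β) c ((1 : ℝ), (0 : ℂ), (0 : ℝ))) c ((0 : ℝ), (0 : ℂ), (1 : ℝ)) -
        (1 / 4 : ℂ) * (lineDeriv ℝ (fun c : ℝ × ℂ × ℝ => lineDeriv ℝ (xiTwoIntegrand g 0 α β) c ((0 : ℝ), (1 : ℂ), (0 : ℝ))) c ((0 : ℝ), (1 : ℂ), (0 : ℝ)) +
          lineDeriv ℝ (fun c : ℝ × ℂ × ℝ => lineDeriv ℝ (xiTwoIntegrand g 0 α β) c ((0 : ℝ), I, (0 : ℝ))) c ((0 : ℝ), I, (0 : ℝ)))) =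
      -(4 * Real.pi ^ 2) * h.det * xiTwo g h α β := by
    have hsplit : ∀ c : ℝ × ℂ × ℝ, cexp (-(2 * Real.pi * I) * (h * hermTwo c).trace) *
        (lineDeriv ℝ (fun c : ℝ × ℂ × ℝ => lineDeriv ℝ (xiTwoIntegrand g 0 α β) c ((1 : ℝ), (0 : ℂ), (0 : ℝ))) c ((0 : ℝ), (0 : ℂ), (1 : ℝ)) -
          (1 / 4 : ℂ) * (lineDeriv ℝ (fun c : ℝ × ℂ × ℝ => lineDeriv ℝ (xiTwoIntegrand g 0 α β) c ((0 : ℝ), (1 : ℂ), (0 : ℝ))) c ((0 : ℝ), (1 : ℂ), (0 : ℝ)) +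
            lineDeriv ℝ (fun c : ℝ × ℂ × ℝ => lineDeriv ℝ (xiTwoIntegrand g 0 α β) c ((0 : ℝ), I, (0 : ℝ))) c ((0 : ℝ), I, (0 : ℝ)))) =
        cexp (-(2 * Real.pi * I) * (h * hermTwo c).trace) *
            lineDeriv ℝ (fun c : ℝ × ℂ × ℝ => lineDeriv ℝ (xiTwoIntegrand g 0 α β) c ((1 : ℝ), (0 : ℂ), (0 : ℝ))) c ((0 : ℝ), (0 : ℂ), (1 : ℝ)) -
          (1 / 4 : ℂ) * (cexp (-(2 * Real.pi * I) * (h * hermTwo c).trace) *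
              lineDeriv ℝ (fun c : ℝ × ℂ × ℝ => lineDeriv ℝ (xiTwoIntegrand g 0 α β) c ((0 : ℝ), (1 : ℂ), (0 : ℝ))) c ((0 : ℝ), (1 : ℂ), (0 : ℝ)) +
            cexp (-(2 * Real.pi * I) * (h * hermTwo c).trace) *
              lineDeriv ℝ (fun c : ℝ × ℂ × ℝ => lineDeriv ℝ (xiTwoIntegrand g 0 α β) c ((0 : ℝ), I, (0 : ℝ))) c ((0 : ℝ), I, (0 : ℝ))) := fun c => by ring
    simp_rw [hsplit]
    have Iq : Integrable (fun c : ℝ × ℂ × ℝ => (1 / 4 : ℂ) * (cexp (-(2 * Real.pi * I) * (h * hermTwo c).trace) *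
        lineDeriv ℝ (fun c : ℝ × ℂ × ℝ => lineDeriv ℝ (xiTwoIntegrand g 0 α β) c ((0 : ℝ), (1 : ℂ), (0 : ℝ))) c ((0 : ℝ), (1 : ℂ), (0 : ℝ)) +
          cexp (-(2 * Real.pi * I) * (h * hermTwo c).trace) *
        lineDeriv ℝ (fun c : ℝ × ℂ × ℝ => lineDeriv ℝ (xiTwoIntegrand g 0 α β) c ((0 : ℝ), I, (0 : ℝ))) c ((0 : ℝ), I, (0 : ℝ)))) := (Iuu.add Ivv).const_mul _
    rw [integral_sub Iab Iq, integral_const_mul, integral_add Iuu Ivv, hab, huu, hvv, ← cayley_charCoeff h]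
    ring
  -- … and from the pointwise Cayley identity
  have hR : ∫ c : ℝ × ℂ × ℝ, cexp (-(2 * Real.pi * I) * (h * hermTwo c).trace) *
      (lineDeriv ℝ (fun c : ℝ × ℂ × ℝ => lineDeriv ℝ (xiTwoIntegrand g 0 α β) c ((1 : ℝ), (0 : ℂ), (0 : ℝ))) c ((0 : ℝ), (0 : ℂ), (1 : ℝ)) -
        (1 / 4 : ℂ) * (lineDeriv ℝ (fun c : ℝ × ℂ × ℝ => lineDeriv ℝ (xiTwoIntegrand g 0 α β) c ((0 : ℝ), (1 : ℂ), (0 : ℝ))) c ((0 : ℝ), (1 : ℂ), (0 : ℝ)) +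
          lineDeriv ℝ (fun c : ℝ × ℂ × ℝ => lineDeriv ℝ (xiTwoIntegrand g 0 α β) c ((0 : ℝ), I, (0 : ℝ))) c ((0 : ℝ), I, (0 : ℝ)))) =
      (α + β - 1) * (α * xiTwo g h (α + 1) β + β * xiTwo g h α (β + 1)) + 4 * α * β * g.det * xiTwo g h (α + 1) (β + 1) := by
    have hpt : ∀ c : ℝ × ℂ × ℝ, cexp (-(2 * Real.pi * I) * (h * hermTwo c).trace) *
        (lineDeriv ℝ (fun c : ℝ × ℂ × ℝ => lineDeriv ℝ (xiTwoIntegrand g 0 α β) c ((1 : ℝ), (0 : ℂ), (0 : ℝ))) c ((0 : ℝ), (0 : ℂ), (1 : ℝ)) -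
          (1 / 4 : ℂ) * (lineDeriv ℝ (fun c : ℝ × ℂ × ℝ => lineDeriv ℝ (xiTwoIntegrand g 0 α β) c ((0 : ℝ), (1 : ℂ), (0 : ℝ))) c ((0 : ℝ), (1 : ℂ), (0 : ℝ)) +
            lineDeriv ℝ (fun c : ℝ × ℂ × ℝ => lineDeriv ℝ (xiTwoIntegrand g 0 α β) c ((0 : ℝ), I, (0 : ℝ))) c ((0 : ℝ), I, (0 : ℝ)))) =
        (α + β - 1) * α * xiTwoIntegrand g h (α + 1) β c + (α + β - 1) * β * xiTwoIntegrand g h α (β + 1) c +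
          4 * α * β * g.det * xiTwoIntegrand g h (α + 1) (β + 1) c := by
      intro c
      rw [cayley_xiTwoIntegrand_zero hg α β c, xiTwoIntegrand_eq_cexp_mul_zero g h (α + 1) β c, xiTwoIntegrand_eq_cexp_mul_zero g h α (β + 1) c,
        xiTwoIntegrand_eq_cexp_mul_zero g h (α + 1) (β + 1) c]
      ring
    simp_rw [hpt]
    have I1 : Integrable (fun c : ℝ × ℂ × ℝ => (α + β - 1) * α * xiTwoIntegrand g h (α + 1) β c) := h10.const_mul _
    have I2 : Integrable (fun c : ℝ × ℂ × ℝ => (α + β - 1) * β * xiTwoIntegrand g h α (β + 1) c) := h01.const_mul _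
    have I3 : Integrable (fun c : ℝ × ℂ × ℝ => 4 * α * β * g.det * xiTwoIntegrand g h (α + 1) (β + 1) c) := h11.const_mul _
    have I12 : Integrable (fun c : ℝ × ℂ × ℝ => (α + β - 1) * α * xiTwoIntegrand g h (α + 1) β c + (α + β - 1) * β * xiTwoIntegrand g h α (β + 1) c) :=
      I1.add I2
    rw [integral_add I12 I3, integral_add I1 I2, integral_const_mul, integral_const_mul, integral_const_mul, xiTwo_def, xiTwo_def, xiTwo_def]
    ring
  rw [← hL, hR]

end IBP

end Summit.HodgeConjecture.HodgeConjecture.Cruxes.HLiu418.K2LiuHermTwoXiCayleyRecursion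

end
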